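import Mathlib
import HarnessLib
import Summits.ValiantsHypothesis.ValiantsHypothesis.Theorems.EquivariantDialLeVerrierIntertwine

/-!
# Equivariant-dc dial: BLOCK-GAUGE LIFT DATA `(M, α, β)` lift Le Verrier's program exactly, layer by layer —
# arrow 2 of Theorem H lands: a block-gauge representation equivariant on `Γ` gives a `Γ`-equivariant layered
# program of length `deg f` and width `n² + n + 1` (decomp-valiant workshop, lens 1, generation 16) — support
# file of census cell A; NOT a route

HONEST FRAMING.  `VP ≠ VNP` is NOT proved here and nothing in this file is progress on it.  Sorry-free SUPPORT
file of the census cell `A = EquivariantDialNode.EqHardBiPerm` (item `stmt-ValiantsHypothesis-23702`).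
Kernel-checked, no `sorry`, no axioms:
* §1 `GL` packaging: Kronecker products (`kronGL`), contragredients (`trInvGL`), block sums (`blockGL`) and
  scalars (`smulGL`) of units, and the inverse-free form of a layer equation (`layer_of_comm`).
* §2 BLOCK-GAUGE LIFT DATA `BlockGauge.LiftData B γ = (M, α, β)`: `Z(γ·x) = M Z M⁻¹`, `c(γ·x) = β⁻¹ M c`,
  `r(γ·x) = α r M⁻¹`, `ℓ(γ·x) = αβ⁻¹ ℓ` — the equations of a BLOCK-DIAGONAL lift `g = diag(α, M)`,
  `h = diag(β, M)` of the affine matrix `[[ℓ, r], [c, 1 + Z]]` (Landsberg–Ressayre [LandsbergRessayre2017,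
  Def 1.3] with the gauge fixed); `BlockGauge.IsEquivariant Γ B` = lift data on all of `Γ`.
* §3 THE LIFT (`LiftData.programLift`): on vertex layer `t` the unit
  `R_t = diag(M⁻ᵀ ⊗ M, β M⁻ᵀ, χ_t)` with `χ_t = 1` (`t ≤ d+1`), `χ_{d+2} = α⁻¹β`, source eigenvalue `1`, sink
  eigenvalue `α⁻¹β`; the layer equations are the intertwining identities of
  `EquivariantDialLeVerrierIntertwine` (`comm_layer`), the source/sink equations are `delta_vecMul_kron` and a
  direct check.  Hence `BlockGauge.hasLayeredWidthLE`: `B.IsEquivariant Γ`, `det B.matrix = f`,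
  `f` a form of degree `d + 2` ⟹ `HasLayeredWidthLE Γ f (d + 2) (n² + n + 1)` — ARROW 2 of Theorem H
  (`EquivariantDialGrading.GradingCost`); arrow 3 is `EquivariantDialLayersGraded`, arrow 1 (equivariant
  ⟹ block gauge, polynomial cost) remains the one honest open stub of the cell-A skeleton.
Census reading: no new cell, no tag change.  No `instance`, no `notation`; nothing from `Literature` restated.
-/

set_option linter.dupNamespace false

namespace Summit.ValiantsHypothesis.ValiantsHypothesis.Theorems.EquivariantDialLayers

open MvPolynomial Matrix Literature.Computability.AlgebraicComplexity
open scoped Kronecker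

noncomputable section

/-! ## §1 `GL` packaging -/

section Units

variable {k : Type*} [CommRing k] {m n : Type*} [Fintype m] [DecidableEq m] [Fintype n] [DecidableEq n]

/-- Kronecker product of units. -/
def kronGL (A : GL m k) (B : GL n k) : GL (m × n) k :=
  ⟨(A : Matrix m m k) ⊗ₖ (B : Matrix n n k), ((A⁻¹ : GL m k) : Matrix m m k) ⊗ₖ ((B⁻¹ : GL n k) : Matrix n n k),
    by rw [← mul_kronecker_mul, Units.mul_inv, Units.mul_inv, one_kronecker_one],
    by rw [← mul_kronecker_mul, Units.inv_mul, Units.inv_mul, one_kronecker_one]⟩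

/-- The contragredient unit `(A⁻¹)ᵀ`. -/
def trInvGL (A : GL n k) : GL n k :=
  ⟨((A⁻¹ : GL n k) : Matrix n n k)ᵀ, (A : Matrix n n k)ᵀ,
    by rw [← transpose_mul, Units.mul_inv, transpose_one],
    by rw [← transpose_mul, Units.inv_mul, transpose_one]⟩

/-- Block-diagonal sum of units. -/
def blockGL (A : GL m k) (B : GL n k) : GL (m ⊕ n) k :=
  ⟨fromBlocks (A : Matrix m m k) 0 0 (B : Matrix n n k),
    fromBlocks ((A⁻¹ : GL m k) : Matrix m m k) 0 0 ((B⁻¹ : GL n k) : Matrix n n k),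
    by simp [fromBlocks_multiply], by simp [fromBlocks_multiply]⟩

/-- The scalar unit `u · 1`. -/
def smulGL (ι : Type*) [Fintype ι] [DecidableEq ι] (u : kˣ) : GL ι k :=
  ⟨(u : k) • (1 : Matrix ι ι k), ((u⁻¹ : kˣ) : k) • (1 : Matrix ι ι k), by simp [smul_smul], by simp [smul_smul]⟩

/-- INVERSE-FREE FORM of a layer equation: `R₁ · T = T' · R₂` gives `T' = R₁ · T · R₂⁻¹`. -/
theorem layer_of_comm {σ V : Type*} [Fintype V] [DecidableEq V] {T T' : Matrix V V (MvPolynomial σ k)}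
    (R₁ R₂ : GL V k) (h : (R₁ : Matrix V V k).map C * T = T' * (R₂ : Matrix V V k).map C) :
    T' = (R₁ : Matrix V V k).map C * T * ((R₂⁻¹ : GL V k) : Matrix V V k).map C := by
  rw [h, Matrix.mul_assoc, ← Matrix.map_mul, Units.mul_inv, Matrix.map_one _ (map_zero C) (map_one C),
    Matrix.mul_one]

end Units

/-! ## §2 Block-gauge lift data -/

namespace BlockGauge

variable {σ : Type*} {k : Type*} [Field k] {n : Type*} [Fintype n] [DecidableEq n] [Fintype σ] [DecidableEq σ]
  (B : BlockGauge σ k n)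

/-- BLOCK-GAUGE LIFT DATA for `γ`: `M ∈ GL_n(k)` and `α, β ∈ kˣ` with `Z(γ·x) = M Z M⁻¹`,
`c(γ·x) = β⁻¹ M c`, `r(γ·x) = α r M⁻¹`, `ℓ(γ·x) = α β⁻¹ ℓ` — the equations of the block-diagonal lift
`[[ℓ, r], [c, 1 + Z]](γ·x) = diag(α, M) · [[ℓ, r], [c, 1 + Z]] · diag(β, M)⁻¹`. -/
structure LiftData (γ : GL σ k) where
  /-- the inner gauge -/
  M : GL n k
  /-- left character -/
  α : kˣ
  /-- right character -/
  β : kˣ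
  mapZ : Matrix.linSubstEntries γ B.Z =
    ((M : Matrix n n k).map C) * B.Z * (((M⁻¹ : GL n k) : Matrix n n k).map C)
  mapc : ∀ i, linSubst σ k γ.val (B.c i) = C ((β⁻¹ : kˣ) : k) * (((M : Matrix n n k).map C) *ᵥ B.c) i
  mapr : ∀ j, linSubst σ k γ.val (B.r j) = C (α : k) * (B.r ᵥ* ((M⁻¹ : GL n k) : Matrix n n k).map C) j
  mapℓ : linSubst σ k γ.val B.ℓ = C ((α : k) * ((β⁻¹ : kˣ) : k)) * B.ℓ

/-- `B` is block-gauge equivariant on `Γ`: lift data at every `γ ∈ Γ`. -/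
def IsEquivariant (Γ : Subgroup (GL σ k)) : Prop := ∀ γ ∈ Γ, Nonempty (B.LiftData γ)

omit [Fintype n] [Fintype σ] [DecidableEq σ] in
/-- The program's layers, by value of the layer index. -/
theorem program_T (d : ℕ) (t : Fin (d + 2)) : (B.program d).T t = B.layerM d t.val := rfl

namespace LiftData

variable {B} {γ : GL σ k} (D : B.LiftData γ) (d : ℕ)

/-- `M` with constant-polynomial entries. -/
def Mc : Matrix n n (MvPolynomial σ k) := (D.M : Matrix n n k).map C

/-- `M⁻¹` with constant-polynomial entries. -/
def Mi : Matrix n n (MvPolynomial σ k) := ((D.M⁻¹ : GL n k) : Matrix n n k).map C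

/-- `M⁻¹ M = 1` at the polynomial level. -/
theorem Mi_mul_Mc : D.Mi * D.Mc = 1 := by
  rw [Mi, Mc, ← Matrix.map_mul, Units.inv_mul, Matrix.map_one _ (map_zero C) (map_one C)]

/-- `β⁻¹ β = 1` at the polynomial level. -/
theorem βi_mul_βc : C ((D.β⁻¹ : kˣ) : k) * (C (D.β : k) : MvPolynomial σ k) = 1 := by
  rw [← map_mul, Units.inv_mul, map_one]

/-- `α⁻¹ α = 1` at the polynomial level. -/
theorem αi_mul_αc : C ((D.α⁻¹ : kˣ) : k) * (C (D.α : k) : MvPolynomial σ k) = 1 := by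
  rw [← map_mul, Units.inv_mul, map_one]

/-- The character on `⋆` at vertex layer `t`: `1` up to layer `d + 1`, `α⁻¹ β` on the sink layer `d + 2`. -/
def chi (t : Fin (d + 3)) : kˣ := if t.val ≤ d + 1 then 1 else D.α⁻¹ * D.β

/-- **The lift on vertex layer `t`**: `diag(M⁻ᵀ ⊗ M, β M⁻ᵀ, χ_t)`. -/
def R (t : Fin (d + 3)) : GL ((n × n) ⊕ (n ⊕ Unit)) k :=
  blockGL (kronGL (trInvGL D.M) D.M) (blockGL (smulGL n D.β * trInvGL D.M) (smulGL Unit (D.chi d t)))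

/-- The lift at the polynomial level, block by block. -/
theorem map_R (t : Fin (d + 3)) :
    ((D.R d t : GL ((n × n) ⊕ (n ⊕ Unit)) k) : Matrix ((n × n) ⊕ (n ⊕ Unit)) ((n × n) ⊕ (n ⊕ Unit)) k).map C =
      fromBlocks (D.Miᵀ ⊗ₖ D.Mc) 0 0
        (fromBlocks ((C (D.β : k) : MvPolynomial σ k) • D.Miᵀ) 0 0
          ((C ((D.chi d t : kˣ) : k) : MvPolynomial σ k) • (1 : Matrix Unit Unit (MvPolynomial σ k)))) := by
  ext a b
  rcases a with ⟨a1, a2⟩ | (i | u) <;> rcases b with ⟨b1, b2⟩ | (j | u') <;>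
    simp [R, blockGL, kronGL, trInvGL, smulGL, Mc, Mi, Matrix.smul_apply]

/-- `χ_t = 1` for `t ≤ d + 1`. -/
theorem chi_of_le {t : Fin (d + 3)} (h : t.val ≤ d + 1) : D.chi d t = 1 := if_pos h

/-- `χ_t = α⁻¹ β` for `t > d + 1`. -/
theorem chi_of_lt {t : Fin (d + 3)} (h : d + 1 < t.val) : D.chi d t = D.α⁻¹ * D.β := if_neg (not_le.mpr h)

/-! ## §3 The layer, source and sink equations -/

/-- **LAYER EQUATIONS** (inverse-free): `R_t · T_t = T_t(γ·x) · R_{t+1}` for every edge layer `t`. -/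
theorem comm_layer (t : Fin (d + 2)) :
    ((D.R d t.castSucc : GL ((n × n) ⊕ (n ⊕ Unit)) k) : Matrix ((n × n) ⊕ (n ⊕ Unit)) ((n × n) ⊕ (n ⊕ Unit)) k).map C * (B.program d).T t =
      Matrix.linSubstEntries γ ((B.program d).T t) *
        ((D.R d t.succ : GL ((n × n) ⊕ (n ⊕ Unit)) k) : Matrix ((n × n) ⊕ (n ⊕ Unit)) ((n × n) ⊕ (n ⊕ Unit)) k).map C := by
  have hZ : B.Z.map (linSubst σ k γ.val) = D.Mc * B.Z * D.Mi := D.mapZ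
  have hc : (fun i => linSubst σ k γ.val (B.c i)) = fun i => C ((D.β⁻¹ : kˣ) : k) * (D.Mc *ᵥ B.c) i :=
    funext D.mapc
  have hr : (fun j => linSubst σ k γ.val (B.r j)) = fun j => C (D.α : k) * (B.r ᵥ* D.Mi) j := funext D.mapr
  have h1 : D.chi d t.castSucc = 1 := D.chi_of_le d (by rw [Fin.val_castSucc]; omega)
  rw [map_R, map_R, h1, program_T, Matrix.linSubstEntries, layerM]
  rcases Nat.lt_trichotomy t.val d with ht | ht | ht
  · -- Le Verrier step
    have h2 : D.chi d t.succ = 1 := D.chi_of_le d (by rw [Fin.val_succ]; omega)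
    rw [if_pos ht, h2, B.stepBlk_eq_raw, Matrix.fromBlocks_map, ← AlgHom.coe_toRingHom, stepRaw_map,
      AlgHom.coe_toRingHom, linSubst_C, hZ]
    simp only [Matrix.map_zero, map_zero, fromBlocks_multiply, Matrix.mul_zero, Matrix.zero_mul, add_zero,
      kron_mul_stepRaw D.Mc D.Mi B.Z D.Mi_mul_Mc]
  · -- collecting layer
    have h2 : D.chi d t.succ = 1 := D.chi_of_le d (by rw [Fin.val_succ]; omega)
    rw [if_neg (by omega), if_pos ht, h2, B.collectBlk_eq_raw, Matrix.fromBlocks_map, ← AlgHom.coe_toRingHom,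
      collectRaw_map, AlgHom.coe_toRingHom, linSubst_C, hZ, hc]
    simp only [Matrix.map_zero, map_zero, fromBlocks_multiply, Matrix.mul_zero, Matrix.zero_mul, add_zero,
      zero_add, Units.val_one, map_one, one_smul, kron_mul_collectRaw D.Mc D.Mi B.Z B.c _ _ D.βi_mul_βc]
  · -- closing layer
    have h2 : D.chi d t.succ = D.α⁻¹ * D.β := D.chi_of_lt d (by rw [Fin.val_succ]; omega)
    have hℓ : linSubst σ k γ.val B.ℓ = C (D.α : k) * C ((D.β⁻¹ : kˣ) : k) * B.ℓ := by rw [D.mapℓ, map_mul]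
    rw [if_neg (by omega), if_neg (by omega), h2, B.sinkBlk_eq_raw, Matrix.fromBlocks_map, ← AlgHom.coe_toRingHom,
      sinkRaw_map, AlgHom.coe_toRingHom, hr, hℓ]
    simp only [Matrix.map_zero, map_zero, fromBlocks_multiply, Matrix.mul_zero, Matrix.zero_mul,
      zero_add, Units.val_one, map_one, one_smul, Units.val_mul, map_mul,
      blocks_mul_sinkRaw D.Mi B.r B.ℓ _ _ _ _ D.αi_mul_αc D.βi_mul_βc]

/-- **SOURCE EQUATION**: `u ᵥ* R_0 = u` (`δ ᵥ* (M⁻ᵀ ⊗ M) = vec(M⁻¹ M) = δ`). -/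
theorem src_eq :
    (B.program d).u ᵥ* ((D.R d 0 : GL ((n × n) ⊕ (n ⊕ Unit)) k) : Matrix ((n × n) ⊕ (n ⊕ Unit)) ((n × n) ⊕ (n ⊕ Unit)) k) = ((1 : kˣ) : k) • (B.program d).u := by
  have hQ : (fun b : n × n => if b.1 = b.2 then (1 : k) else 0) ᵥ*
      ((((D.M⁻¹ : GL n k) : Matrix n n k))ᵀ ⊗ₖ (D.M : Matrix n n k)) = fun b => if b.1 = b.2 then 1 else 0 :=
    delta_vecMul_kron _ _ (by rw [Units.inv_mul]) 1
  show srcVec k n ᵥ* fromBlocks ((((D.M⁻¹ : GL n k) : Matrix n n k))ᵀ ⊗ₖ (D.M : Matrix n n k)) 0 0 _ =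
    ((1 : kˣ) : k) • srcVec k n
  rw [srcVec, Matrix.vecMul_fromBlocks]
  simp only [Sum.elim_comp_inl, Sum.elim_comp_inr, Matrix.zero_vecMul, Matrix.vecMul_zero, add_zero, hQ,
    Units.val_one, one_smul]

/-- **SINK EQUATION**: `R_{d+2} v = α⁻¹β · v`. -/
theorem snk_eq : ((D.R d (Fin.last (d + 2)) : GL ((n × n) ⊕ (n ⊕ Unit)) k) : Matrix ((n × n) ⊕ (n ⊕ Unit)) ((n × n) ⊕ (n ⊕ Unit)) k) *ᵥ (B.program d).v =
    ((D.α⁻¹ * D.β : kˣ) : k) • (B.program d).v := by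
  have h2 : D.chi d (Fin.last (d + 2)) = D.α⁻¹ * D.β := D.chi_of_lt d (by rw [Fin.val_last]; omega)
  show fromBlocks _ 0 0 (fromBlocks _ 0 0 ((D.chi d (Fin.last (d + 2)) : k) • (1 : Matrix Unit Unit k))) *ᵥ
      snkVec k n = ((D.α⁻¹ * D.β : kˣ) : k) • snkVec k n
  rw [h2, snkVec, Matrix.fromBlocks_mulVec]
  funext q
  rcases q with a | (i | u) <;> simp [Matrix.fromBlocks_mulVec, Matrix.smul_mulVec, Matrix.one_mulVec]

/-- **THE LIFT.**  Block-gauge lift data lift Le Verrier's program exactly, layer by layer. -/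
def programLift : (B.program d).Lift γ where
  R := D.R d
  a := 1
  b := D.α⁻¹ * D.β
  layer t := layer_of_comm _ _ (D.comm_layer d t)
  src := D.src_eq d
  snk := D.snk_eq d

end LiftData

/-- Block-gauge equivariance on `Γ` makes Le Verrier's program `Γ`-equivariant. -/
theorem nonempty_lift_program {Γ : Subgroup (GL σ k)} (hB : B.IsEquivariant Γ) (d : ℕ) :
    ∀ γ ∈ Γ, Nonempty ((B.program d).Lift γ) := fun γ hγ => (hB γ hγ).map fun D => D.programLift d

/-- **ARROW 2 OF THEOREM H.**  A block-gauge representation `det [[ℓ, r], [c, 1 + Z]] = f` of a form `f` of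
degree `d + 2`, block-gauge equivariant on `Γ`, yields a `Γ`-equivariant homogeneous layered program for `f`
of length `d + 2` on `n × n ⊔ n ⊔ ⋆`. -/
theorem hasLayeredWidthLE [CharZero k] {Γ : Subgroup (GL σ k)} (hB : B.IsEquivariant Γ) {d : ℕ}
    {f : MvPolynomial σ k} (hf : f.IsHomogeneous (d + 2)) (hdet : B.matrix.det = f) :
    HasLayeredWidthLE Γ f (d + 2) (Fintype.card ((n × n) ⊕ (n ⊕ Unit))) :=
  B.hasLayeredWidthLE_of_lifts d (B.nonempty_lift_program hB d) hf hdet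

end BlockGauge

end

end Summit.ValiantsHypothesis.ValiantsHypothesis.Theorems.EquivariantDialLayers
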